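import Summits.QuantumAdvantage.QuantumAdvantage.Theorems.RandomOracleGaugeAAConjAssembly
import Summits.QuantumAdvantage.QuantumAdvantage.Theorems.RandomOracleGaugeOneBlockDecoupling
import Summits.QuantumAdvantage.QuantumAdvantage.Theorems.RandomOracleGaugeVarianceAmplificationStubOuterPoly
import Summits.QuantumAdvantage.QuantumAdvantage.Theorems.RandomOracleGaugeVarianceAmplificationStubAverage
import Summits.QuantumAdvantage.QuantumAdvantage.Theorems.RandomOracleGaugeVarianceAmplificationStubClip
import Summits.QuantumAdvantage.QuantumAdvantage.Theorems.RandomOracleGaugeVarianceAmplificationStubParams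

/-!
# Route `RandomOracleGauge`, crux `VarianceAmplification` (stmt-QuantumAdvantage-17874) — PROVED

VARIANCE AMPLIFICATION at polynomial cost (the strategist's elementary reduction for the Aaronson–Ambainis
conjecture, line `average-and-clip`): there are absolute `v > 0`, `K`, `κ` such that from every
`[0,1]`-bounded `p` of degree `≤ d` with `Var p ≥ ε > 0` one builds a `[0,1]`-bounded `q` on some `Fin N'` of
total degree `≤ D ≤ K d/ε^κ` with `Var q ≥ v` and every influence of `q` at most `(K/ε^κ) ×` some influence of
`p`. Construction: average `m = ⌈100/ε⌉` independent copies of `p − E p` (`stub_average`), clip at five standard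
deviations through an explicit soft-sign polynomial of gain `k ≈ 1/(2·sd)` (`stub_outerPoly`, `stub_clip`), with
the parameter bookkeeping of `stub_params`; `v = 10⁻⁶`.

This file is the COMPOSITION of the registered line `Cruxes/AAConj/Lines/average_and_clip.lean` (its theorem
`VarianceAmplification_of`, re-proved here verbatim because a Theorems file cannot import a Cruxes file) applied to
the four stubs, all landed in the tree BY NAME (`…StubOuterPoly`, `…StubAverage`, `…StubClip`, `…StubParams`).
**`VarianceAmplification_proof`** closes the crux BY NAME. Consequence: with `OneBlockDecoupling_proof`
(`Theorems/RandomOracleGaugeOneBlockDecoupling.lean`) and `AAConj_of_subs` (`…AAConjAssembly.lean`), the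
Aaronson–Ambainis conjecture as filed (`AAConj`) — and hence the crux `PseudoBoundedAA` of route `SosSandwich`
(`pseudoBoundedAA_of_aaConj`) — is reduced to the single open core `DecoupledCoreAA` (`AAConj_of_decoupledCore`).
No named facts beyond proved tree theorems; axioms standard.
-/

-- D-0017: single-conjunct summit ⇒ the duplicate `QuantumAdvantage.QuantumAdvantage` is mandated.
set_option linter.dupNamespace false

noncomputable section

open Literature.Computability.QuantumComplexity
open Summit.QuantumAdvantage.QuantumAdvantage.Cruxes.VarianceAmplification.AverageAndClip
  (stub_outerPoly stub_average stub_clip stub_params)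

namespace Summit.QuantumAdvantage.QuantumAdvantage.Theorems.RandomOracleGauge

/-- **The crux `VarianceAmplification` (stmt-QuantumAdvantage-17874), BY NAME** — with `v = 10⁻⁶`,
`κ_tot = κ + 2`, `K_tot = K·2^κ + 5` from the outer-polynomial constants `(κ, K) = (2, 3)`: the composition
`VarianceAmplification_of` of the registered line `average-and-clip` applied to the landed stubs.
[folklore: averaging and clipping] -/
theorem VarianceAmplification_proof :
    Summit.QuantumAdvantage.QuantumAdvantage.Theses.RandomOracleGauge.VarianceAmplification := by
  obtain ⟨κ₁, K₁, hK₁, hP⟩ := stub_outerPoly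
  refine ⟨1 / 1000000, K₁ * 2 ^ κ₁ + 5, κ₁ + 2, by norm_num, by positivity, ?_⟩
  intro N d p ε hd hdeg hb hε hεv
  -- the variance level `V` of `p`
  set V : ℝ := boolVariance p with hVdef
  have hV1 : V ≤ 1 := boolVariance_le_one' hb
  have hε1 : ε ≤ 1 := hεv.trans hV1
  have hd1 : (1 : ℝ) ≤ d := by exact_mod_cast hd
  -- parameters, averaged polynomial, outer polynomial, clipped polynomial
  obtain ⟨m, k, t, hm1, hmle, hk1, hkle, ht, htk, hVt, hE⟩ := stub_params ε V hε hεv hV1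
  have hm1' : (1 : ℝ) ≤ m := by exact_mod_cast hm1
  have hk1' : (1 : ℝ) ≤ k := by exact_mod_cast hk1
  obtain ⟨s, hsdeg, hsb, hsmean, hs2, hs4, hsinf⟩ := stub_average N d m p hm1 hdeg hb
  obtain ⟨S, hSdeg, hSP⟩ := hP k hk1
  have hE4 := hE (boolAvg (fun x => evalBool s x ^ 4)) (boolAvg_nonneg fun _ => by positivity) hs4
  have hA : boolAvg (fun x => evalBool s x ^ 4) ≤ t ^ 2 * boolAvg (fun x => evalBool s x ^ 2) := by
    rw [hs2]; exact hE4.1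
  have hB : boolAvg (fun x => evalBool s x ^ 2) ≤ t ^ 2 := by rw [hs2]; exact hVt
  obtain ⟨Y, hYdeg, hYb, hYinf, hYvar⟩ := stub_clip (m * N) s S k t hk1 hSP hsb hsmean ht htk hA hB
  -- outputs
  refine ⟨m * N, S.natDegree * d + 1, Y, Nat.le_add_left 1 _, ?_, ?_, hYb, ?_, ?_⟩
  · -- degree bound: S.natDegree * d + 1 ≤ K₁ k^κ₁ d + 1 ≤ (K₁ 2^κ₁ + 5) d / ε^(κ₁+2)
    have h1 : ((S.natDegree * d + 1 : ℕ) : ℝ) = S.natDegree * d + 1 := by push_cast; ring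
    rw [h1]
    have hkpow : (k : ℝ) ^ κ₁ ≤ (2 / ε) ^ κ₁ := pow_le_pow_left₀ (by positivity) hkle κ₁
    have h2 : (S.natDegree : ℝ) * d ≤ K₁ * (2 / ε) ^ κ₁ * d := by
      have := mul_le_mul_of_nonneg_right hSdeg (show (0 : ℝ) ≤ d by positivity)
      refine this.trans ?_
      exact mul_le_mul_of_nonneg_right (mul_le_mul_of_nonneg_left hkpow hK₁.le) (by positivity)
    have hεp : 0 < ε ^ (κ₁ + 2) := by positivity
    have hεle : ε ^ (κ₁ + 2) ≤ ε ^ κ₁ := pow_le_pow_of_le_one hε.le hε1 (by omega)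
    have hε1' : ε ^ (κ₁ + 2) ≤ 1 := pow_le_one₀ hε.le hε1
    rw [le_div_iff₀ hεp]
    have h3 : (2 / ε) ^ κ₁ * ε ^ (κ₁ + 2) ≤ 2 ^ κ₁ := by
      rw [div_pow]
      calc 2 ^ κ₁ / ε ^ κ₁ * ε ^ (κ₁ + 2) ≤ 2 ^ κ₁ / ε ^ κ₁ * ε ^ κ₁ :=
            mul_le_mul_of_nonneg_left hεle (by positivity)
        _ = 2 ^ κ₁ := by field_simp
    calc ((S.natDegree : ℝ) * d + 1) * ε ^ (κ₁ + 2)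
        ≤ (K₁ * (2 / ε) ^ κ₁ * d + 1) * ε ^ (κ₁ + 2) := mul_le_mul_of_nonneg_right (by linarith) hεp.le
      _ = K₁ * d * ((2 / ε) ^ κ₁ * ε ^ (κ₁ + 2)) + ε ^ (κ₁ + 2) := by ring
      _ ≤ K₁ * d * 2 ^ κ₁ + 1 := add_le_add (mul_le_mul_of_nonneg_left h3 (by positivity)) hε1'
      _ ≤ K₁ * d * 2 ^ κ₁ + 5 * d := by linarith
      _ = (K₁ * 2 ^ κ₁ + 5) * d := by ring
  · -- total degree of Y
    calc Y.totalDegree ≤ S.natDegree * s.totalDegree := hYdeg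
      _ ≤ S.natDegree * d := Nat.mul_le_mul_left _ hsdeg
      _ ≤ S.natDegree * d + 1 := Nat.le_succ _
  · -- the absolute variance level
    rw [hs2] at hYvar
    exact hE4.2.trans hYvar
  · -- influences: Inf_j Y ≤ k² Inf_j s ≤ k² Inf_i p / m² ≤ (2/ε)² Inf_i p ≤ K_tot / ε^(κ₁+2) Inf_i p
    intro j
    obtain ⟨i, hi⟩ := hsinf j
    refine ⟨i, (hYinf j).trans ?_⟩
    have hIp : 0 ≤ influence i p := influence_nonneg i p
    have hm2 : (1 : ℝ) ≤ (m : ℝ) ^ 2 := one_le_pow₀ hm1'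
    have step1 : (k : ℝ) ^ 2 * influence j s ≤ (k : ℝ) ^ 2 * influence i p := by
      apply mul_le_mul_of_nonneg_left _ (by positivity)
      exact hi.trans (div_le_self hIp hm2)
    have hk2 : (k : ℝ) ^ 2 ≤ (2 / ε) ^ 2 := pow_le_pow_left₀ (by positivity) hkle 2
    have hεpow : ε ^ (κ₁ + 2) ≤ ε ^ 2 := pow_le_pow_of_le_one hε.le hε1 (by omega)
    calc (k : ℝ) ^ 2 * influence j s ≤ (k : ℝ) ^ 2 * influence i p := step1
      _ ≤ (2 / ε) ^ 2 * influence i p := mul_le_mul_of_nonneg_right hk2 hIp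
      _ = 4 / ε ^ 2 * influence i p := by rw [div_pow]; norm_num
      _ ≤ 4 / ε ^ (κ₁ + 2) * influence i p := by
          apply mul_le_mul_of_nonneg_right _ hIp
          exact div_le_div_of_nonneg_left (by norm_num) (by positivity) hεpow
      _ ≤ (K₁ * 2 ^ κ₁ + 5) / ε ^ (κ₁ + 2) * influence i p := by
          apply mul_le_mul_of_nonneg_right _ hIp
          apply div_le_div_of_nonneg_right _ (by positivity)
          have : (0 : ℝ) ≤ K₁ * 2 ^ κ₁ := by positivity
          linarith

/-- **The Aaronson–Ambainis conjecture as filed is now reduced to its decoupled core**: `DecoupledCoreAA → AAConj`,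
by the assembly `AAConj_of_subs` with the two reduction cruxes discharged (`OneBlockDecoupling_proof`,
`VarianceAmplification_proof`). [cite: ODonnellZhao2016, Cor. 2.12 and Thm. 2.13] -/
theorem AAConj_of_decoupledCore
    (hCore : Summit.QuantumAdvantage.QuantumAdvantage.Theses.RandomOracleGauge.DecoupledCoreAA) :
    Summit.QuantumAdvantage.QuantumAdvantage.Theses.RandomOracleGauge.AAConj :=
  AAConj_of_subs hCore OneBlockDecoupling_proof VarianceAmplification_proof

end Summit.QuantumAdvantage.QuantumAdvantage.Theorems.RandomOracleGauge

end
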